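import Mathlib.Analysis.SpecialFunctions.Log.Deriv
import Mathlib.Analysis.Convex.Mul
import HarnessLib

/-!
# The port component of the sextic isolation law `(Q6)` is preserved by pendant extension of the port

Support file for crux `stmt-CriticalPhenomena-4575` (`NoHeavyLowerTail`), seat `prim-facecert` gen 19
(`--supports stmt-CriticalPhenomena-4575`).  No definitions, no sorries, standard axioms.  It puts into the kernel THEOREM 1 of the
lead memo `run/shared/lean/prim/prim-l12/FROM-prim-nh-lead-4575-g115-Q6-LAW-ALGEBRA.md` §6 (lead gen 115, INEQ-CLAIMS addendum 6), the one
algebraic lemma to which `(Q6)`/`(C½)` on the whole tower / fan closure reduces (memo §5), complementing the pointwise face lemma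
`…ThreePointIsoSexticFace` (`(Q6)_port ⟹ (C½)`) and prim-l12-p1 gen 21's `…ThreePointIsoQuartic` (`(Q6)` on parallel compositions of `(K)`-pieces).

For three terminals `a, b, h` of a finite weighted graph write the partition law as `x = P(abh)`, `s = P(ab|h)`, `t = P(ah|b)`, `u = P(bh|a)`,
`q = P(a|b|h)` and `Q = q`, `I_a = P(a isolated) = q+u`, `I_b = q+t`, `I_h = q+s`, `z = P(a ≁ b) = q+t+u`.  The PORT component of `(Q6)` at the
port `h` is `Q⁶ ≤ I_a³ · I_b³ · I_h²`.  PENDANT (more generally ARM) EXTENSION of the port: glue at `h` an arbitrary two–terminal network `(h, w)`,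
edge-disjoint from the gadget, with `P(h ↔ w in the arm) = α`, and take `w` as the new port (`h` becomes internal).  By independence the new
isolation coordinates are the two-point mixtures
`Q' = αq + (1−α)z`, `I_a' = α(q+u) + (1−α)z`, `I_b' = α(q+t) + (1−α)z`, `I_w' = α(q+s) + (1−α)`.

* `isoSexticPort_ray` — the normalised statement (memo §6, `a' = t/z, b' = u/z, c' = 1−q−s, d' = a'+b'`): for `a, b, c, p ∈ [0,1]` with
  `a + b ≤ 1`, **`(1−a−b)⁶ ≤ (1−a)³(1−b)³(1−c)²  ⟹  (1−p(a+b))⁶ ≤ (1−pa)³(1−pb)³(1−pc)²`**; i.e. the region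
  `{(1−a−b)⁶ ≤ (1−a)³(1−b)³(1−c)²}` of the box is star-shaped about the origin.
* `isoSexticPort_pendant` — the law-coordinate form: `q⁶ ≤ (q+u)³(q+t)³(q+s)² ⟹ Q'⁶ ≤ I_a'³·I_b'³·I_w'²` for every `α ∈ [0,1]`.
* `isoSexticPort_prod`, `isoSexticPort_fan` — parallel composition at the three terminals multiplies `Q` and every `I_v`
  (`ThreePointPieces.real_isoP/real_sepP`), so the port component is preserved by products; a FAN (rays glued at `(a,b)`, apex `w` joined to ray
  `i`'s port with probability `αᵢ`) is the product of the pendant-extended rays: `(Q6)_w` for the fan from `(Q6)_{hᵢ}` for every ray.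
With `ThreePointIsoSexticFace.face_half_of_isoSexticPort` this gives `(C½)` (`τ_face ≤ ½`) at the port of every gadget of the
{parallel₃, pendant, fan}-closure of the `(Q6)_port`-gadgets (all towers, fans of fans, any depth): the fixed point `½` of the fan
renormalisation is never crossed by a tower-type construction (memo §6 Cor. 4; graph-level bookkeeping of the closure is not in this file).

PROOF of `isoSexticPort_ray` (memo §6, made differentiation-free).  WLOG `a+b < 1`, `c < 1`.  The log-margin
`f(p) = log[(1−pa)³(1−pb)³(1−pc)²] − log[(1−p(a+b))⁶]` has the convergent expansion `f(p) = Σ_{k≥1} (h_k/k) p^k`,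
`h_k = 6(a+b)^k − 3a^k − 3b^k − 2c^k` (`Real.hasSum_pow_div_log_of_abs_lt_one`).  SIGN PATTERN (`coef_neg_of_le`): `h_j < 0 ⟹ h_k < 0` for all
`k ≥ j` — if `2c > 3(a+b)` every `h_k` is negative (power mean `a^k + b^k ≥ 2((a+b)/2)^k` and `3·2^k ≤ 3 + 3^k`), otherwise
`h_k/(a+b)^k = 6 − 3x^k − 3y^k − 2ρ^k` is a discretely CONCAVE sequence with nonnegative first term, and a concave sequence that goes negative stays
negative (`concaveSeq_neg_of_neg`).  Hence with `m + 1` the first negative index (or no negative index at all) the comparison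
`(h_k/k)·p^k ≥ (h_k/k)·p^m` holds TERMWISE for `p ∈ [0,1]`, so `f(p) ≥ p^m f(1) ≥ 0` (`hasSum_le`), and `f(1) ≥ 0` is the hypothesis.
-/

namespace Summit.CriticalPhenomena.PercolationContinuityZ3.Theorems.ThreePointIsoSexticPendant

open Finset

/-! ## 1. Concave sequences: once negative, negative forever -/

/-- A discretely concave real sequence `u` (second differences `≤ 0`) with `u 0 ≥ 0` which is negative at `j` is negative at every
`k ≥ j`.  (Chord bound `(n+1)(u(n+1) − u(n)) ≤ u(n+1) − u(0)`, then the increments stay negative.) [folklore] -/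
theorem concaveSeq_neg_of_neg (u : ℕ → ℝ) (hu : ∀ n, u (n + 2) - u (n + 1) ≤ u (n + 1) - u n) (h0 : 0 ≤ u 0)
    {j k : ℕ} (hjk : j ≤ k) (hj : u j < 0) : u k < 0 := by
  have A : ∀ n : ℕ, ((n : ℝ) + 1) * (u (n + 1) - u n) ≤ u (n + 1) - u 0 := by
    intro n
    induction n with
    | zero => simp
    | succ n ih =>
      have h2 : ((n : ℝ) + 1) * (u (n + 2) - u (n + 1)) ≤ ((n : ℝ) + 1) * (u (n + 1) - u n) :=
        mul_le_mul_of_nonneg_left (hu n) (by positivity)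
      have e : u (n + 1 + 1) = u (n + 2) := rfl
      rw [e]; push_cast; linarith
  induction k, hjk using Nat.le_induction with
  | base => exact hj
  | succ k _ ih =>
    cases k with
    | zero => exact absurd h0 (not_le.mpr ih)
    | succ n =>
      have hA := A n
      have hδ : u (n + 1) - u n < 0 := by
        by_contra hcon
        push Not at hcon
        have : 0 ≤ ((n : ℝ) + 1) * (u (n + 1) - u n) := mul_nonneg (by positivity) hcon
        linarith
      have h3 := hu n
      show u (n + 2) < 0
      linarith

/-! ## 2. The coefficients `h_k = 6(a+b)^k − 3a^k − 3b^k − 2c^k` (index `k = n + 1`) -/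

/-- If `2c > 3(a+b)` (`a, b ≥ 0`) then every coefficient `h_k = 6(a+b)^k − 3a^k − 3b^k − 2c^k`, `k ≥ 1`, is negative
(`k = 1`: `3(a+b) − 2c < 0`; `k ≥ 2`: `a^k + b^k ≥ 2((a+b)/2)^k`, `c^k > (3(a+b)/2)^k` and `3·2^k ≤ 3 + 3^k`). [this work] -/
theorem coef_neg_of_large {a b c : ℝ} (ha : 0 ≤ a) (hb : 0 ≤ b) (hc : 3 * (a + b) < 2 * c) (n : ℕ) :
    6 * (a + b) ^ (n + 1) - 3 * a ^ (n + 1) - 3 * b ^ (n + 1) - 2 * c ^ (n + 1) < 0 := by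
  cases n with
  | zero => simp only [zero_add, pow_one]; linarith
  | succ m =>
    set e := (a + b) / 2 with he
    have he0 : 0 ≤ e := by rw [he]; positivity
    have hmean : 2 * e ^ (m + 2) ≤ a ^ (m + 2) + b ^ (m + 2) := by
      have hcv := (convexOn_pow (m + 2)).2 (Set.mem_Ici.2 ha) (Set.mem_Ici.2 hb)
        (by norm_num : (0:ℝ) ≤ 1 / 2) (by norm_num : (0:ℝ) ≤ 1 / 2) (by norm_num)
      simp only [smul_eq_mul] at hcv
      have e2 : (1 / 2 : ℝ) * a + 1 / 2 * b = e := by rw [he]; ring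
      rw [e2] at hcv
      linarith
    have h3e : 3 * e < c := by rw [he]; linarith
    have h3e0 : 0 ≤ 3 * e := by positivity
    have hpow : (3 * e) ^ (m + 2) < c ^ (m + 2) := pow_lt_pow_left₀ h3e h3e0 (by omega)
    have hnat : (3 : ℝ) * 2 ^ (m + 2) ≤ 3 + 3 ^ (m + 2) := by
      have key : ∀ k : ℕ, 3 * 2 ^ (k + 2) ≤ 3 + 3 ^ (k + 2) := by
        intro k
        induction k with
        | zero => norm_num
        | succ k ih =>
          have h9 : 9 ≤ 3 ^ (k + 2) := by
            calc (9:ℕ) = 3 ^ 2 := by norm_num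
              _ ≤ 3 ^ (k + 2) := Nat.pow_le_pow_right (by norm_num) (by omega)
          have e1 : 3 * 2 ^ (k + 1 + 2) = 2 * (3 * 2 ^ (k + 2)) := by ring
          have e3 : 3 ^ (k + 1 + 2) = 3 * 3 ^ (k + 2) := by ring
          rw [e1, e3]
          omega
      exact_mod_cast key m
    have hd : (a + b) ^ (m + 2) = 2 ^ (m + 2) * e ^ (m + 2) := by
      rw [← mul_pow]; congr 1; rw [he]; ring
    have h3 : (3 * e) ^ (m + 2) = 3 ^ (m + 2) * e ^ (m + 2) := mul_pow _ _ _
    have hem : 0 ≤ e ^ (m + 2) := pow_nonneg he0 _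
    have key : 6 * (a + b) ^ (m + 2) ≤ 6 * e ^ (m + 2) + 2 * (3 * e) ^ (m + 2) := by
      rw [hd, h3]
      have := mul_le_mul_of_nonneg_left hnat hem
      linarith
    show 6 * (a + b) ^ (m + 2) - 3 * a ^ (m + 2) - 3 * b ^ (m + 2) - 2 * c ^ (m + 2) < 0
    linarith

/-- **Sign pattern of the coefficients.**  For `a, b, c ≥ 0` the sequence `h_k = 6(a+b)^k − 3a^k − 3b^k − 2c^k` (`k ≥ 1`) changes sign at
most once, from `+` to `−`: if `h_j < 0` then `h_k < 0` for every `k ≥ j` (stated with the index shift `k = n + 1`). [this work] -/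
theorem coef_neg_of_le {a b c : ℝ} (ha : 0 ≤ a) (hb : 0 ≤ b) (hc : 0 ≤ c) {j k : ℕ} (hjk : j ≤ k)
    (hj : 6 * (a + b) ^ (j + 1) - 3 * a ^ (j + 1) - 3 * b ^ (j + 1) - 2 * c ^ (j + 1) < 0) :
    6 * (a + b) ^ (k + 1) - 3 * a ^ (k + 1) - 3 * b ^ (k + 1) - 2 * c ^ (k + 1) < 0 := by
  rcases lt_or_ge (3 * (a + b)) (2 * c) with hbig | hsmall
  · exact coef_neg_of_large ha hb hbig k
  have hd0 : 0 ≤ a + b := add_nonneg ha hb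
  rcases eq_or_lt_of_le hd0 with hzero | hpos
  · -- `a = b = 0`, hence `c = 0`, and `h_j = 0`: contradiction
    exfalso
    have ha0 : a = 0 := by linarith
    have hb0 : b = 0 := by linarith
    have hc0 : c = 0 := by linarith
    rw [ha0, hb0, hc0] at hj; simp at hj
  · set d := a + b with hd
    have hdne : d ≠ 0 := ne_of_gt hpos
    -- normalised variables and the concave sequence `v n = h_{n+1} / d^{n+1}`
    set x := a / d with hx
    set y := b / d with hy
    set ρ := c / d with hρ
    have hx0 : 0 ≤ x := div_nonneg ha hd0
    have hy0 : 0 ≤ y := div_nonneg hb hd0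
    have hρ0 : 0 ≤ ρ := div_nonneg hc hd0
    have hrepr : ∀ n : ℕ, 6 * d ^ (n + 1) - 3 * a ^ (n + 1) - 3 * b ^ (n + 1) - 2 * c ^ (n + 1) =
        d ^ (n + 1) * (6 - 3 * x ^ (n + 1) - 3 * y ^ (n + 1) - 2 * ρ ^ (n + 1)) := by
      intro n
      have ea : d ^ (n + 1) * x ^ (n + 1) = a ^ (n + 1) := by
        rw [← mul_pow, hx, mul_div_cancel₀ _ hdne]
      have eb : d ^ (n + 1) * y ^ (n + 1) = b ^ (n + 1) := by
        rw [← mul_pow, hy, mul_div_cancel₀ _ hdne]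
      have ec : d ^ (n + 1) * ρ ^ (n + 1) = c ^ (n + 1) := by
        rw [← mul_pow, hρ, mul_div_cancel₀ _ hdne]
      rw [← ea, ← eb, ← ec]
      ring
    have hconc : ∀ n : ℕ, (6 - 3 * x ^ (n + 2 + 1) - 3 * y ^ (n + 2 + 1) - 2 * ρ ^ (n + 2 + 1)) -
          (6 - 3 * x ^ (n + 1 + 1) - 3 * y ^ (n + 1 + 1) - 2 * ρ ^ (n + 1 + 1)) ≤
        (6 - 3 * x ^ (n + 1 + 1) - 3 * y ^ (n + 1 + 1) - 2 * ρ ^ (n + 1 + 1)) -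
          (6 - 3 * x ^ (n + 1) - 3 * y ^ (n + 1) - 2 * ρ ^ (n + 1)) := by
      intro n
      have hpos3 : 0 ≤ 3 * (x ^ (n + 1) * (x - 1) ^ 2) + 3 * (y ^ (n + 1) * (y - 1) ^ 2) +
          2 * (ρ ^ (n + 1) * (ρ - 1) ^ 2) := by positivity
      have e : ((6 - 3 * x ^ (n + 2 + 1) - 3 * y ^ (n + 2 + 1) - 2 * ρ ^ (n + 2 + 1)) -
            (6 - 3 * x ^ (n + 1 + 1) - 3 * y ^ (n + 1 + 1) - 2 * ρ ^ (n + 1 + 1))) -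
          ((6 - 3 * x ^ (n + 1 + 1) - 3 * y ^ (n + 1 + 1) - 2 * ρ ^ (n + 1 + 1)) -
            (6 - 3 * x ^ (n + 1) - 3 * y ^ (n + 1) - 2 * ρ ^ (n + 1))) =
          -(3 * (x ^ (n + 1) * (x - 1) ^ 2) + 3 * (y ^ (n + 1) * (y - 1) ^ 2) +
            2 * (ρ ^ (n + 1) * (ρ - 1) ^ 2)) := by ring
      linarith
    have hxy : x + y = 1 := by
      rw [hx, hy, ← add_div, div_self hdne]
    have hρ32 : 2 * ρ ≤ 3 := by
      rw [hρ]
      rw [show 2 * (c / d) = (2 * c) / d by ring, div_le_iff₀ hpos]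
      linarith
    have hv0 : 0 ≤ 6 - 3 * x ^ (0 + 1) - 3 * y ^ (0 + 1) - 2 * ρ ^ (0 + 1) := by
      simp only [zero_add, pow_one]
      linarith
    have hsign : ∀ n : ℕ, 6 * d ^ (n + 1) - 3 * a ^ (n + 1) - 3 * b ^ (n + 1) - 2 * c ^ (n + 1) < 0 ↔
        6 - 3 * x ^ (n + 1) - 3 * y ^ (n + 1) - 2 * ρ ^ (n + 1) < 0 := by
      intro n
      rw [hrepr n]
      have hdn : 0 < d ^ (n + 1) := pow_pos hpos _
      exact ⟨fun h => neg_of_mul_neg_right h hdn.le, fun h => mul_neg_of_pos_of_neg hdn h⟩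
    exact (hsign k).2 (concaveSeq_neg_of_neg (fun n => 6 - 3 * x ^ (n + 1) - 3 * y ^ (n + 1) - 2 * ρ ^ (n + 1))
      hconc hv0 hjk ((hsign j).1 hj))

/-! ## 3. The log-margin as a power series and the ray theorem -/

/-- Power-series expansion of the log-margin along the pendant path: for `a, b, c ≥ 0`, `a + b < 1`, `c < 1`, `p ∈ [0,1]`,
`log[(1−pa)³(1−pb)³(1−pc)²] − log[(1−p(a+b))⁶] = Σ_{k ≥ 1} p^k · h_k / k` with `h_k = 6(a+b)^k − 3a^k − 3b^k − 2c^k`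
(from `−log(1−y) = Σ y^k/k`, `Real.hasSum_pow_div_log_of_abs_lt_one`). [this work] -/
theorem hasSum_logMargin {a b c p : ℝ} (ha : 0 ≤ a) (hb : 0 ≤ b) (hc : 0 ≤ c) (hab : a + b < 1) (hc1 : c < 1)
    (hp0 : 0 ≤ p) (hp1 : p ≤ 1) :
    HasSum (fun n : ℕ => p ^ (n + 1) *
        ((6 * (a + b) ^ (n + 1) - 3 * a ^ (n + 1) - 3 * b ^ (n + 1) - 2 * c ^ (n + 1)) / (n + 1)))
      (Real.log ((1 - p * a) ^ 3 * (1 - p * b) ^ 3 * (1 - p * c) ^ 2) - Real.log ((1 - p * (a + b)) ^ 6)) := by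
  have hle : ∀ y : ℝ, 0 ≤ y → p * y ≤ y := fun y hy0 => by
    calc p * y ≤ 1 * y := mul_le_mul_of_nonneg_right hp1 hy0
      _ = y := one_mul y
  have habs : ∀ y : ℝ, 0 ≤ y → y < 1 → |p * y| < 1 := fun y hy0 hy1 => by
    rw [abs_of_nonneg (mul_nonneg hp0 hy0)]
    exact (hle y hy0).trans_lt hy1
  have ha1 : a < 1 := by linarith
  have hb1 : b < 1 := by linarith
  have hA := Real.hasSum_pow_div_log_of_abs_lt_one (habs a ha ha1)
  have hB := Real.hasSum_pow_div_log_of_abs_lt_one (habs b hb hb1)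
  have hC := Real.hasSum_pow_div_log_of_abs_lt_one (habs c hc hc1)
  have hD := Real.hasSum_pow_div_log_of_abs_lt_one (habs (a + b) (add_nonneg ha hb) hab)
  have h := (hD.mul_left 6).sub (((hA.mul_left 3).add (hB.mul_left 3)).add (hC.mul_left 2))
  have h1a : 0 < 1 - p * a := by linarith [hle a ha]
  have h1b : 0 < 1 - p * b := by linarith [hle b hb]
  have h1c : 0 < 1 - p * c := by linarith [hle c hc]
  have h1d : 0 < 1 - p * (a + b) := by linarith [hle (a + b) (add_nonneg ha hb)]
  have feq : (fun n : ℕ => p ^ (n + 1) *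
        ((6 * (a + b) ^ (n + 1) - 3 * a ^ (n + 1) - 3 * b ^ (n + 1) - 2 * c ^ (n + 1)) / (n + 1))) =
      (fun n : ℕ => 6 * ((p * (a + b)) ^ (n + 1) / (n + 1)) -
        (3 * ((p * a) ^ (n + 1) / (n + 1)) + 3 * ((p * b) ^ (n + 1) / (n + 1)) + 2 * ((p * c) ^ (n + 1) / (n + 1)))) := by
    funext n
    rw [mul_pow, mul_pow, mul_pow, mul_pow]
    ring
  have veq : Real.log ((1 - p * a) ^ 3 * (1 - p * b) ^ 3 * (1 - p * c) ^ 2) - Real.log ((1 - p * (a + b)) ^ 6) =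
      6 * -Real.log (1 - p * (a + b)) - (3 * -Real.log (1 - p * a) + 3 * -Real.log (1 - p * b) + 2 * -Real.log (1 - p * c)) := by
    rw [Real.log_mul (mul_ne_zero (pow_ne_zero _ h1a.ne') (pow_ne_zero _ h1b.ne')) (pow_ne_zero _ h1c.ne'),
      Real.log_mul (pow_ne_zero _ h1a.ne') (pow_ne_zero _ h1b.ne'),
      Real.log_pow, Real.log_pow, Real.log_pow, Real.log_pow]
    push_cast
    ring
  rw [feq, veq]
  exact h

/-- **The port component of `(Q6)` is preserved along the pendant path (normalised form; memo §6 Theorem 1).**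
For `a, b, c, p ∈ [0,1]` with `a + b ≤ 1`:
`(1−a−b)⁶ ≤ (1−a)³(1−b)³(1−c)²  ⟹  (1−p(a+b))⁶ ≤ (1−pa)³(1−pb)³(1−pc)²`.
Equivalently the set `{(a,b,c) : (1−a−b)⁶ ≤ (1−a)³(1−b)³(1−c)²}` in the box is star-shaped about `0`. [this work] -/
theorem isoSexticPort_ray {a b c p : ℝ} (ha : 0 ≤ a) (hb : 0 ≤ b) (hc : 0 ≤ c) (hab : a + b ≤ 1) (hc1 : c ≤ 1)
    (hp0 : 0 ≤ p) (hp1 : p ≤ 1) (hyp : (1 - (a + b)) ^ 6 ≤ (1 - a) ^ 3 * (1 - b) ^ 3 * (1 - c) ^ 2) :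
    (1 - p * (a + b)) ^ 6 ≤ (1 - p * a) ^ 3 * (1 - p * b) ^ 3 * (1 - p * c) ^ 2 := by
  rcases eq_or_lt_of_le hab with hd1 | hd1
  · -- `a + b = 1`: `(1−p)⁶ ≤ (1−p)⁵ ≤ ((1−pa)(1−pb))³ (1−pc)²`
    have hq : 0 ≤ 1 - p := by linarith
    have h1 : 1 - p ≤ (1 - p * a) * (1 - p * b) := by
      have hab' : b = 1 - a := by linarith
      rw [hab']
      nlinarith [mul_nonneg ha (show 0 ≤ 1 - a by linarith), sq_nonneg p]
    have h2 : 1 - p ≤ 1 - p * c := by nlinarith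
    have h3 : (1 - p) ^ 3 ≤ ((1 - p * a) * (1 - p * b)) ^ 3 := pow_le_pow_left₀ hq h1 3
    have h4 : (1 - p) ^ 2 ≤ (1 - p * c) ^ 2 := pow_le_pow_left₀ hq h2 2
    have h5 : (1 - p) ^ 6 ≤ (1 - p) ^ 5 := pow_le_pow_of_le_one hq (by linarith) (by norm_num)
    calc (1 - p * (a + b)) ^ 6 = (1 - p) ^ 6 := by rw [hd1]; ring
      _ ≤ (1 - p) ^ 5 := h5
      _ = (1 - p) ^ 3 * (1 - p) ^ 2 := by ring
      _ ≤ ((1 - p * a) * (1 - p * b)) ^ 3 * (1 - p * c) ^ 2 :=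
          mul_le_mul h3 h4 (pow_nonneg hq 2) (pow_nonneg (hq.trans h1) 3)
      _ = (1 - p * a) ^ 3 * (1 - p * b) ^ 3 * (1 - p * c) ^ 2 := by ring
  · -- main case `a + b < 1`; then `c < 1`
    have hc1' : c < 1 := by
      by_contra hcon
      push Not at hcon
      have hcc : c = 1 := le_antisymm hc1 hcon
      rw [hcc] at hyp
      have hpos : 0 < (1 - (a + b)) ^ 6 := pow_pos (by linarith) 6
      norm_num at hyp
      linarith
    classical
    set H : ℕ → ℝ := fun n => 6 * (a + b) ^ (n + 1) - 3 * a ^ (n + 1) - 3 * b ^ (n + 1) - 2 * c ^ (n + 1)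
      with hH
    have hS := hasSum_logMargin ha hb hc hd1 hc1' hp0 hp1
    have hS1 := hasSum_logMargin ha hb hc hd1 hc1' zero_le_one le_rfl
    simp only [one_pow, one_mul] at hS1
    have hf1 : 0 ≤ Real.log ((1 - a) ^ 3 * (1 - b) ^ 3 * (1 - c) ^ 2) - Real.log ((1 - (a + b)) ^ 6) := by
      have hDpos : 0 < (1 - (a + b)) ^ 6 := pow_pos (by linarith) 6
      have := Real.log_le_log hDpos hyp
      linarith
    have hle : ∀ y : ℝ, 0 ≤ y → p * y ≤ y := fun y hy0 => by
      calc p * y ≤ 1 * y := mul_le_mul_of_nonneg_right hp1 hy0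
        _ = y := one_mul y
    have h1a : 0 < 1 - p * a := by linarith [hle a ha]
    have h1b : 0 < 1 - p * b := by linarith [hle b hb]
    have h1c : 0 < 1 - p * c := by linarith [hle c hc]
    have h1d : 0 < 1 - p * (a + b) := by linarith [hle (a + b) (add_nonneg ha hb)]
    have hNpos : 0 < (1 - p * a) ^ 3 * (1 - p * b) ^ 3 * (1 - p * c) ^ 2 := by positivity
    have hDpos : 0 < (1 - p * (a + b)) ^ 6 := by positivity
    rw [← Real.log_le_log_iff hDpos hNpos, ← sub_nonneg]
    by_cases hneg : ∃ n, H n < 0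
    · set m := Nat.find hneg with hm
      have hmspec : H m < 0 := Nat.find_spec hneg
      have hmin : ∀ n, n < m → ¬ H n < 0 := fun n hn => Nat.find_min hneg hn
      have hterm : ∀ n : ℕ, p ^ m * (H n / (n + 1)) ≤ p ^ (n + 1) * (H n / (n + 1)) := by
        intro n
        rcases lt_or_ge (H n) 0 with hn | hn
        · have hnm : m ≤ n := by
            by_contra h'
            push Not at h'
            exact hmin n h' hn
          have hp : p ^ (n + 1) ≤ p ^ m := pow_le_pow_of_le_one hp0 hp1 (by omega)
          have hq : H n / (n + 1) ≤ 0 := div_nonpos_of_nonpos_of_nonneg hn.le (by positivity)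
          exact mul_le_mul_of_nonpos_right hp hq
        · have hnm : n + 1 ≤ m := by
            by_contra h'
            push Not at h'
            have hlt := coef_neg_of_le ha hb hc (show m ≤ n by omega) hmspec
            have : H n < 0 := hlt
            linarith
          have hp : p ^ m ≤ p ^ (n + 1) := pow_le_pow_of_le_one hp0 hp1 hnm
          have hq : 0 ≤ H n / (n + 1) := div_nonneg hn (by positivity)
          exact mul_le_mul_of_nonneg_right hp hq
      have hcmp := hasSum_le hterm (hS1.mul_left (p ^ m)) hS
      have h0 : 0 ≤ p ^ m * (Real.log ((1 - a) ^ 3 * (1 - b) ^ 3 * (1 - c) ^ 2) - Real.log ((1 - (a + b)) ^ 6)) :=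
        mul_nonneg (pow_nonneg hp0 m) hf1
      linarith
    · push Not at hneg
      exact hS.nonneg fun n => mul_nonneg (pow_nonneg hp0 _) (div_nonneg (hneg n) (by positivity))

/-! ## 4. Law coordinates, products, fans -/

/-- **PENDANT LEMMA (port component of `(Q6)`, law coordinates).**  Let `x, s, t, u, q ≥ 0` with `x+s+t+u+q = 1` be the partition law of
three terminals `(a, b; h)` (`x = P(abh)`, `s = P(ab|h)`, `t = P(ah|b)`, `u = P(bh|a)`, `q = P(a|b|h)`), satisfying the port component of
`(Q6)`: `q⁶ ≤ (q+u)³(q+t)³(q+s)²` (`Q⁶ ≤ I_a³I_b³I_h²`).  Extend the port by an arm with `P(h ↔ w in the arm) = α ∈ [0,1]` (a pendant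
edge of probability `α`, say).  Then the new law satisfies the port component at the new port `w`:
`Q'⁶ ≤ I_a'³·I_b'³·I_w'²` with `Q' = αq + (1−α)z`, `I_a' = α(q+u) + (1−α)z`, `I_b' = α(q+t) + (1−α)z`, `I_w' = α(q+s) + (1−α)`,
`z = q+t+u = P(a ≁ b)`. [this work] -/
theorem isoSexticPort_pendant {x s t u q α : ℝ} (hx : 0 ≤ x) (hs : 0 ≤ s) (ht : 0 ≤ t) (hu : 0 ≤ u) (hq : 0 ≤ q)
    (hsum : x + s + t + u + q = 1) (hα0 : 0 ≤ α) (hα1 : α ≤ 1)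
    (h6 : q ^ 6 ≤ (q + u) ^ 3 * (q + t) ^ 3 * (q + s) ^ 2) :
    (α * q + (1 - α) * (q + t + u)) ^ 6 ≤
      (α * (q + u) + (1 - α) * (q + t + u)) ^ 3 * (α * (q + t) + (1 - α) * (q + t + u)) ^ 3 *
        (α * (q + s) + (1 - α)) ^ 2 := by
  have hz0 : 0 ≤ q + t + u := by positivity
  rcases eq_or_lt_of_le hz0 with hz | hz
  · have hq0 : q = 0 := by linarith
    have ht0 : t = 0 := by linarith
    have hu0 : u = 0 := by linarith
    rw [hq0, ht0, hu0]
    norm_num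
  · have hzne : q + t + u ≠ 0 := ne_of_gt hz
    -- normalised coordinates
    have key := isoSexticPort_ray (a := t / (q + t + u)) (b := u / (q + t + u)) (c := x + t + u) (p := α)
      (div_nonneg ht hz0) (div_nonneg hu hz0) (by positivity)
      (by rw [← add_div, div_le_one hz]; linarith) (by linarith) hα0 hα1 ?_
    · have eL : (α * q + (1 - α) * (q + t + u)) ^ 6 =
          (q + t + u) ^ 6 * (1 - α * (t / (q + t + u) + u / (q + t + u))) ^ 6 := by
        rw [← mul_pow]; congr 1; field_simp; ring
      have eR : (α * (q + u) + (1 - α) * (q + t + u)) ^ 3 * (α * (q + t) + (1 - α) * (q + t + u)) ^ 3 *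
            (α * (q + s) + (1 - α)) ^ 2 =
          (q + t + u) ^ 6 * ((1 - α * (t / (q + t + u))) ^ 3 * (1 - α * (u / (q + t + u))) ^ 3 *
            (1 - α * (x + t + u)) ^ 2) := by
        have e1 : α * (q + u) + (1 - α) * (q + t + u) = (q + t + u) * (1 - α * (t / (q + t + u))) := by
          field_simp; ring
        have e2 : α * (q + t) + (1 - α) * (q + t + u) = (q + t + u) * (1 - α * (u / (q + t + u))) := by
          field_simp; ring
        have e3 : α * (q + s) + (1 - α) = 1 - α * (x + t + u) := by linear_combination α * hsum
        rw [e1, e2, e3]; ring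
      rw [eL, eR]
      exact mul_le_mul_of_nonneg_left key (by positivity)
    · -- the hypothesis in normalised form
      have e0 : 1 - (t / (q + t + u) + u / (q + t + u)) = q / (q + t + u) := by field_simp; ring
      have e1 : 1 - t / (q + t + u) = (q + u) / (q + t + u) := by field_simp; ring
      have e2 : 1 - u / (q + t + u) = (q + t) / (q + t + u) := by field_simp; ring
      have e3 : 1 - (x + t + u) = q + s := by linear_combination (-1 : ℝ) * hsum
      rw [e0, e1, e2, e3, div_pow, div_pow, div_pow]
      have hz6 : 0 < (q + t + u) ^ 6 := pow_pos hz 6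
      rw [div_le_iff₀ hz6]
      calc q ^ 6 ≤ (q + u) ^ 3 * (q + t) ^ 3 * (q + s) ^ 2 := h6
        _ = (q + u) ^ 3 / (q + t + u) ^ 3 * ((q + t) ^ 3 / (q + t + u) ^ 3) * (q + s) ^ 2 * (q + t + u) ^ 6 := by
            field_simp

/-- **Products (parallel composition at the three terminals).**  If `Qᵢ ≥ 0` and `Qᵢ⁶ ≤ Aᵢ³·Bᵢ³·Wᵢ²` for every `i ∈ S` then
`(∏ Qᵢ)⁶ ≤ (∏ Aᵢ)³·(∏ Bᵢ)³·(∏ Wᵢ)²`.  Parallel composition at `{a,b,h}` multiplies `Q` and every isolation coordinate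
(`ThreePointPieces.real_isoP`, `real_sepP`), so the port component of `(Q6)` passes to joins. [this work] -/
theorem isoSexticPort_prod {ι : Type*} (S : Finset ι) (Q A B W : ι → ℝ) (hQ : ∀ i ∈ S, 0 ≤ Q i)
    (h : ∀ i ∈ S, Q i ^ 6 ≤ A i ^ 3 * B i ^ 3 * W i ^ 2) :
    (∏ i ∈ S, Q i) ^ 6 ≤ (∏ i ∈ S, A i) ^ 3 * (∏ i ∈ S, B i) ^ 3 * (∏ i ∈ S, W i) ^ 2 := by
  rw [← prod_pow, ← prod_pow, ← prod_pow, ← prod_pow, ← prod_mul_distrib, ← prod_mul_distrib]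
  exact prod_le_prod (fun i hi => pow_nonneg (hQ i hi) 6) h

/-- **FAN STEP for the port component of `(Q6)` (law level).**  A fan glues rays `i ∈ S` (laws `(xᵢ,sᵢ,tᵢ,uᵢ,qᵢ)` of `(a,b;hᵢ)`) at `(a,b)`
and joins a new apex `w` to the port `hᵢ` of ray `i` with probability `αᵢ`; it is the parallel composition at `{a,b,w}` of the
pendant-extended rays, so its isolation coordinates are the products of the pendant coordinates.  If every ray satisfies the port
component `qᵢ⁶ ≤ (qᵢ+uᵢ)³(qᵢ+tᵢ)³(qᵢ+sᵢ)²`, then so does the fan at its apex: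
`(∏ Q'ᵢ)⁶ ≤ (∏ I_a'ᵢ)³ (∏ I_b'ᵢ)³ (∏ I_w'ᵢ)²`.  Iterating (towers, fans of fans) never leaves the law. [this work] -/
theorem isoSexticPort_fan {ι : Type*} (S : Finset ι) (x s t u q α : ι → ℝ)
    (hx : ∀ i ∈ S, 0 ≤ x i) (hs : ∀ i ∈ S, 0 ≤ s i) (ht : ∀ i ∈ S, 0 ≤ t i) (hu : ∀ i ∈ S, 0 ≤ u i)
    (hq : ∀ i ∈ S, 0 ≤ q i) (hsum : ∀ i ∈ S, x i + s i + t i + u i + q i = 1)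
    (hα0 : ∀ i ∈ S, 0 ≤ α i) (hα1 : ∀ i ∈ S, α i ≤ 1)
    (h6 : ∀ i ∈ S, q i ^ 6 ≤ (q i + u i) ^ 3 * (q i + t i) ^ 3 * (q i + s i) ^ 2) :
    (∏ i ∈ S, (α i * q i + (1 - α i) * (q i + t i + u i))) ^ 6 ≤
      (∏ i ∈ S, (α i * (q i + u i) + (1 - α i) * (q i + t i + u i))) ^ 3 *
        (∏ i ∈ S, (α i * (q i + t i) + (1 - α i) * (q i + t i + u i))) ^ 3 *
          (∏ i ∈ S, (α i * (q i + s i) + (1 - α i))) ^ 2 := by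
  refine isoSexticPort_prod S _ _ _ _ (fun i hi => ?_) (fun i hi => ?_)
  · have h1 : 0 ≤ 1 - α i := sub_nonneg.2 (hα1 i hi)
    have := hq i hi; have := ht i hi; have := hu i hi; have := hα0 i hi
    positivity
  · exact isoSexticPort_pendant (hx i hi) (hs i hi) (ht i hi) (hu i hi) (hq i hi) (hsum i hi) (hα0 i hi) (hα1 i hi) (h6 i hi)

end Summit.CriticalPhenomena.PercolationContinuityZ3.Theorems.ThreePointIsoSexticPendant
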